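import Summits.Ventures.CertifiedArithmetic.LowPrec.GemmFirstRegimeSpineBase
import HarnessLib

/-!
# GEMM worst case LXIV-b — THE SPINE THEOREM: `(T + d)·|ŝ_n - s_n| ≤ d·L_n` for every HIGH word
# of the first regime (integer form)

HONEST FRAMING: certified error envelopes and provably optimal rounding/accumulation schemes for
low-precision formats under stated cost models; every table by two implementations; no hardware or
vendor claims.

Setting (integers, grid units): letters `z_i`, `T = 2^(m+1)`, accumulators
`acc_{i+1} = rneZ m (acc_i + z_{i+1})`, exact up to `j₀` (`acc_{j₀} = s_{j₀}`), the two arguments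
`acc_{j₀} + z_{j₀+1}`, `acc_{j₀+1} + z_{j₀+2}` below `2T` (this is `Q ≥ M + 2` of file LXIV-c),
every step nearest (`|δ_i| ≤ |z_{i+1}|`), `n = j₀ + 1 + d` with `d + 1 ≤ T/2`, and SOME argument
`V_i = acc_i + z_{i+1}`, `j₀ ≤ i < n`, of modulus `≥ 2T` (a HIGH word; low words are file LXIII-a).
The content is for `d ≥ 2`: at `d ≤ 1` every argument `V_i`, `j₀ ≤ i < n`, is one of the two entry
arguments, so the high-word hypothesis contradicts the entry hypotheses and the statements are vacuous.
CLAIM (`spineZ`): `T·E_n ≤ d·(L_n - E_n)`, `E = acc - s`, `L = Σ|z|`; with the mirror word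
(`z ↦ -z`, `rneZ_neg`) this is `(T+d)|E_n| ≤ d·L_n` (`spineZ_abs`), i.e. `R ≤ d/(T+d)`.

PROOF.  Let `2^(m+2+e')` be the top dyadic level reached by some `|V_i|` (all `|V_i| <
2^(m+3+e')`), `h = 2^e'`, `U = 2T·h ≥ 2T`, and `i_b = j₀+1+a` the FIRST index with `|V| ≥ U`
(`a ≥ 1` by the two entry hypotheses), `b = i_b + 1`.  Before `i_b` every argument is `< U`, so
(`rneZ_err_le`) the entry step errs by `≤ 1` and the next `a - 1… a` steps by `≤ h`:
`E_{i_b} ≤ 1 + a·h`.  At the U-step (`rneZ_level` at level `e'+1`): `|acc_b| ≥ U`, sign kept,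
`4h ∣ acc_b`, `|δ| ≤ 2h`, and `8h ∣ acc_b` at a tie; also `4h, 8h ∣ U` (`m ≥ 1`).  BASE
`T·E_b + (d-1-a)·U ≤ d·X⁻_b` (file LXIV-a): on the negative side `X⁻_b ≥ -acc_b ≥ U`; on the
positive side `X⁻_b ≥ acc_b - 2E_b` and either `δ ≤ 0` (`acc_b ≥ U`, `E_b ≤ 1 + a h`), or
`0 < δ < 2h` (`acc_b > V ≥ U`, both multiples of `4h`: `acc_b ≥ U + 4h`), or `δ = 2h` (a tie:
`8h ∣ acc_b > U`, `8h ∣ U`: `acc_b ≥ U + 8h`) — the last case is where TIES-TO-EVEN is needed.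
PROPAGATION (`spine_propagate`): every later step has `|V| < 2U`, so errs by `≤ 2h = U/T`, and
`X⁻` never decreases (`|δ| ≤ |z|`); after the `d-1-a` remaining steps `T·E_n ≤ d·X⁻_n`.

References: [Higham2002, §4.2], [IEEE7542019, §4.3.1], [LangeRump2019], [BoldoEtAl2023, Thm 4.5].
-/

namespace Summit.Ventures.CertifiedArithmetic.LowPrec.Gemm

open Literature.ComputerArithmetic.FloatingPoint
open Literature.ComputerArithmetic.FloatingPoint.MiniFloat
open Literature.ComputerArithmetic.JeannerodRump2018
open Finset

variable {φ : Format}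

/-! ### The spine theorem in integers -/

/-- THE SIGNED SPINE BOUND (integer form). Letters `z`, accumulators `acc` with
`acc (i+1) = rneZ m (acc i + z (i+1))`, exact up to `j₀`, entry argument and the next one below
`2T = 2^(m+2)`, `|δ| ≤ |z|` at every step, `d + 1 ≤ T/2`, and SOME step from the entry on at or
above `2T` (a high word; this forces `d ≥ 2` — at `d ≤ 1` the hypotheses are contradictory and the
statement is vacuous). Then `T·(ŝ_n - s_n) ≤ d·(L_n - (ŝ_n - s_n))`, `n = j₀ + 1 + d`.
[cell, gemm.tex Prop. p:fpL] -/
theorem spineZ {m j0 d : ℕ} {z acc : ℕ → ℤ} (hm : 1 ≤ m) (hd : d + 1 ≤ 2 ^ m)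
    (hacc : ∀ i, i < j0 + 1 + d → acc (i + 1) = rneZ m (acc i + z (i + 1)))
    (hpre : acc j0 = sZ z j0)
    (hV0 : (acc j0 + z (j0 + 1)).natAbs < 2 ^ (m + 2))
    (hV1 : (acc (j0 + 1) + z (j0 + 1 + 1)).natAbs < 2 ^ (m + 2))
    (hδ : ∀ i, i < j0 + 1 + d →
      (acc (i + 1) - (acc i + z (i + 1))).natAbs ≤ (z (i + 1)).natAbs)
    (hhigh : ∃ i, j0 ≤ i ∧ i < j0 + 1 + d ∧ 2 ^ (m + 2) ≤ (acc i + z (i + 1)).natAbs) :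
    2 ^ (m + 1) * (acc (j0 + 1 + d) - sZ z (j0 + 1 + d))
      ≤ (d : ℤ) * (LZ z (j0 + 1 + d) - (acc (j0 + 1 + d) - sZ z (j0 + 1 + d))) := by
  classical
  -- opaque names
  obtain ⟨n, hn⟩ : ∃ n, n = j0 + 1 + d := ⟨_, rfl⟩
  obtain ⟨T, hT⟩ : ∃ T : ℤ, T = 2 ^ (m + 1) := ⟨_, rfl⟩
  obtain ⟨E, hE⟩ : ∃ E : ℕ → ℤ, E = fun j => acc j - sZ z j := ⟨_, rfl⟩
  obtain ⟨X, hX⟩ : ∃ X : ℕ → ℤ, X = fun j => LZ z j - E j := ⟨_, rfl⟩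
  have hEj : ∀ j, E j = acc j - sZ z j := fun j => by rw [hE]
  have hXj : ∀ j, X j = LZ z j - E j := fun j => by rw [hX]
  rw [← hn] at hacc hδ hhigh ⊢
  rw [← hT, ← hEj, ← hXj]
  have hEsucc : ∀ i, E (i + 1) = E i + (acc (i + 1) - (acc i + z (i + 1))) := by
    intro i; rw [hEj, hEj, sZ_succ]; ring
  have hXsucc : ∀ i, X (i + 1)
      = X i + (((z (i + 1)).natAbs : ℤ) - (acc (i + 1) - (acc i + z (i + 1)))) := by
    intro i; rw [hXj, hXj, hEsucc, LZ_succ]; ring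
  have hE0 : E j0 = 0 := by rw [hEj, hpre, sub_self]
  have hT4 : (4 : ℤ) ≤ T := by
    rw [hT]
    calc (4 : ℤ) = 2 ^ 2 := by norm_num
      _ ≤ 2 ^ (m + 1) := pow_le_pow_right₀ (by norm_num) (by omega)
  have hdT : 2 * (d : ℤ) + 2 ≤ T := by
    have h1 : ((d + 1 : ℕ) : ℤ) ≤ ((2 ^ m : ℕ) : ℤ) := by exact_mod_cast hd
    push_cast at h1
    have h2 : T = 2 * 2 ^ m := by rw [hT]; ring
    linarith
  -- the top level `e' + 1`: every argument from the entry on is `< 2^(m+2+(e'+1))`, one is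
  -- `≥ 2^(m+2+e')`
  have hP : ∃ e, ∀ i, j0 ≤ i → i < n → (acc i + z (i + 1)).natAbs < 2 ^ (m + 2 + e) := by
    refine ⟨∑ i ∈ range n, (acc i + z (i + 1)).natAbs, fun i _ hi => ?_⟩
    have h1 : (acc i + z (i + 1)).natAbs ≤ ∑ i ∈ range n, (acc i + z (i + 1)).natAbs :=
      single_le_sum (f := fun i => (acc i + z (i + 1)).natAbs) (fun _ _ => Nat.zero_le _)
        (mem_range.mpr hi)
    exact lt_of_le_of_lt h1
      (lt_of_lt_of_le Nat.lt_two_pow_self (Nat.pow_le_pow_right (by norm_num) (by omega)))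
  have hP0 : ¬ ∀ i, j0 ≤ i → i < n → (acc i + z (i + 1)).natAbs < 2 ^ (m + 2 + 0) := by
    intro h
    obtain ⟨i, hi1, hi2, hi3⟩ := hhigh
    exact absurd (h i hi1 hi2) (not_lt.mpr (by simpa using hi3))
  obtain ⟨e', hPe, hnPe⟩ : ∃ e', (∀ i, j0 ≤ i → i < n →
      (acc i + z (i + 1)).natAbs < 2 ^ (m + 2 + (e' + 1))) ∧
      ¬ ∀ i, j0 ≤ i → i < n → (acc i + z (i + 1)).natAbs < 2 ^ (m + 2 + e') := by
    have hfpos : 0 < Nat.find hP := by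
      rw [Nat.pos_iff_ne_zero]; intro h; exact hP0 (h ▸ Nat.find_spec hP)
    refine ⟨Nat.find hP - 1, ?_, Nat.find_min hP (by omega)⟩
    rw [Nat.sub_add_cancel hfpos]; exact Nat.find_spec hP
  -- the first U-step `ib`, `U = 2^(m+2+e')`
  have hQ : ∃ i, j0 ≤ i ∧ i < n ∧ 2 ^ (m + 2 + e') ≤ (acc i + z (i + 1)).natAbs := by
    by_contra h; exact hnPe fun i h1 h2 => lt_of_not_ge fun h3 => h ⟨i, h1, h2, h3⟩
  obtain ⟨ib, ⟨hib1, hib2, hib3⟩, hlowU⟩ : ∃ ib, (j0 ≤ ib ∧ ib < n ∧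
      2 ^ (m + 2 + e') ≤ (acc ib + z (ib + 1)).natAbs) ∧
      ∀ i, j0 ≤ i → i < ib → (acc i + z (i + 1)).natAbs < 2 ^ (m + 2 + e') :=
    ⟨Nat.find hQ, Nat.find_spec hQ, fun i h1 h2 => by
      by_contra h
      exact Nat.find_min hQ h2 ⟨h1, lt_trans h2 (Nat.find_spec hQ).2.1, not_lt.mp h⟩⟩
  have hpow0 : 2 ^ (m + 2) ≤ 2 ^ (m + 2 + e') := Nat.pow_le_pow_right (by norm_num) (by omega)
  have hib0 : ib ≠ j0 := by rintro rfl; omega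
  have hib1' : ib ≠ j0 + 1 := by rintro rfl; omega
  obtain ⟨a, ha1, hiba⟩ : ∃ a, 1 ≤ a ∧ ib = j0 + 1 + a := ⟨ib - j0 - 1, by omega, by omega⟩
  subst hiba
  have had : a + 1 ≤ d := by omega
  -- constants `h = 2^e'`, `U = 2Th = 2^(m+2+e')`
  obtain ⟨Hh, hHh⟩ : ∃ Hh : ℤ, Hh = 2 ^ e' := ⟨_, rfl⟩
  obtain ⟨U, hU⟩ : ∃ U : ℤ, U = 2 * T * Hh := ⟨_, rfl⟩
  have hHh1 : (1 : ℤ) ≤ Hh := by rw [hHh]; exact one_le_pow₀ (by norm_num)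
  have hHhN : ((2 ^ e' : ℕ) : ℤ) = Hh := by rw [hHh]; push_cast; ring
  have hHN : ((2 ^ (e' + 1) : ℕ) : ℤ) = 2 * Hh := by rw [hHh]; push_cast; ring
  have hUN : ((2 ^ (m + 2 + e') : ℕ) : ℤ) = U := by rw [hU, hT, hHh]; push_cast; ring
  obtain ⟨Mh, hMh⟩ : ∃ Mh : ℤ, T = 4 * Mh := by
    obtain ⟨m', rfl⟩ : ∃ m', m = m' + 1 := ⟨m - 1, by omega⟩
    exact ⟨2 ^ m', by rw [hT]; ring⟩
  have h4H : (2 : ℤ) ^ (e' + 1 + 1) = 4 * Hh := by rw [hHh]; ring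
  have h8H : (2 : ℤ) ^ (e' + 1 + 2) = 8 * Hh := by rw [hHh]; ring
  have hU4 : (4 * Hh : ℤ) ∣ U := ⟨2 * Mh, by rw [hU, hMh]; ring⟩
  have hU8 : (8 * Hh : ℤ) ∣ U := ⟨Mh, by rw [hU, hMh]; ring⟩
  -- the signed error before the U-step: `E_{j₀+1+t} ≤ 1 + t·h` for `t ≤ a`
  have hEpre : ∀ t, t ≤ a → E (j0 + 1 + t) ≤ 1 + (t : ℤ) * Hh := by
    intro t
    induction t with
    | zero =>
        intro _
        have h1 := rneZ_err_le (m := m) 0 (K := acc j0 + z (j0 + 1)) (by simpa using hV0)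
        rw [← hacc j0 (by omega)] at h1
        obtain ⟨h2, -⟩ := le_of_natAbs_le' h1
        rw [Nat.add_zero, hEsucc j0, hE0]
        push_cast at h2 ⊢
        linarith
    | succ t ih =>
        intro ht
        have hlt : (acc (j0 + 1 + t) + z (j0 + 1 + t + 1)).natAbs < 2 ^ (m + e' + 2) := by
          rw [show m + e' + 2 = m + 2 + e' by omega]
          exact hlowU _ (by omega) (by omega)
        have h1 := rneZ_err_le (m := m) e' hlt
        rw [← hacc (j0 + 1 + t) (by omega)] at h1
        obtain ⟨h2, -⟩ := le_of_natAbs_le' h1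
        rw [hHhN] at h2
        have h3 := ih (by omega)
        rw [show j0 + 1 + (t + 1) = j0 + 1 + t + 1 by omega, hEsucc]
        push_cast
        linarith
  have hEib : E (j0 + 1 + a) ≤ 1 + (a : ℤ) * Hh := hEpre a le_rfl
  -- the U-step
  have hKlo : 2 ^ (m + (e' + 1) + 1) ≤ (acc (j0 + 1 + a) + z (j0 + 1 + a + 1)).natAbs := by
    rwa [show m + (e' + 1) + 1 = m + 2 + e' by omega]
  have hKhi : (acc (j0 + 1 + a) + z (j0 + 1 + a + 1)).natAbs < 2 ^ (m + (e' + 1) + 2) := by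
    rw [show m + (e' + 1) + 2 = m + 2 + (e' + 1) by omega]; exact hPe _ hib1 hib2
  obtain ⟨hR1, hR2, hR3, hR4, hR5, hR6⟩ := rneZ_level hKlo hKhi
  rw [← hacc (j0 + 1 + a) hib2] at hR1 hR2 hR3 hR4 hR5 hR6
  rw [show m + (e' + 1) + 1 = m + 2 + e' by omega] at hR1
  rw [h4H] at hR2
  rw [h8H] at hR4
  obtain ⟨hδ1, hδ2⟩ := le_of_natAbs_le' hR3
  rw [hHN] at hδ1 hδ2
  have hEb : E (j0 + 1 + a + 1) = E (j0 + 1 + a)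
      + (acc (j0 + 1 + a + 1) - (acc (j0 + 1 + a) + z (j0 + 1 + a + 1))) := hEsucc _
  have hLs := abs_sZ_le_LZ z (j0 + 1 + a + 1)
  have hXb : X (j0 + 1 + a + 1) = LZ z (j0 + 1 + a + 1) - E (j0 + 1 + a + 1) := hXj _
  have hEbv : E (j0 + 1 + a + 1) = acc (j0 + 1 + a + 1) - sZ z (j0 + 1 + a + 1) := hEj _
  have hT0 : (0 : ℤ) ≤ T := by linarith
  have hd0 : (0 : ℤ) ≤ d := Nat.cast_nonneg d
  have ha1z : (1 : ℤ) ≤ a := by exact_mod_cast ha1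
  -- BASE: `T·E_b + (d-1-a)·U ≤ d·X_b` at `b = j₀+2+a`
  have hbase : T * E (j0 + 1 + a + 1) + ((d : ℤ) - 1 - a) * U ≤ d * X (j0 + 1 + a + 1) := by
    have hKne : acc (j0 + 1 + a) + z (j0 + 1 + a + 1) ≠ 0 := by
      intro h; rw [h] at hib3; simp at hib3
    rcases lt_or_gt_of_ne hKne with hneg | hpos
    · -- negative side
      have hsb : acc (j0 + 1 + a + 1) ≤ -U := by have := hR6 hneg; omega
      refine spine_base_neg hU hT0 hHh1 ha1z hd0 (by linarith) ?_
      rw [hXb, hEbv]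
      have := neg_abs_le (sZ z (j0 + 1 + a + 1))
      linarith
    · -- positive side
      have hVU : U ≤ acc (j0 + 1 + a) + z (j0 + 1 + a + 1) := by omega
      have hsb : U ≤ acc (j0 + 1 + a + 1) := by have := hR5 hpos; omega
      have hXlow : acc (j0 + 1 + a + 1) - 2 * E (j0 + 1 + a + 1) ≤ X (j0 + 1 + a + 1) := by
        rw [hXb, hEbv]
        have := le_abs_self (sZ z (j0 + 1 + a + 1))
        linarith
      by_cases hup : acc (j0 + 1 + a + 1) - (acc (j0 + 1 + a) + z (j0 + 1 + a + 1)) ≤ 0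
      · exact spine_base_pos0 hU hdT hHh1 ha1z hd0 (by linarith) hsb hXlow
      · by_cases htie : acc (j0 + 1 + a + 1) - (acc (j0 + 1 + a) + z (j0 + 1 + a + 1)) = 2 * Hh
        · -- a tie, to even: `8h ∣ ŝ_b`, hence `ŝ_b ≥ U + 8h`
          have hdv : (8 * Hh : ℤ) ∣ acc (j0 + 1 + a + 1) := hR4 (by omega)
          have hsb' : U + 8 * Hh ≤ acc (j0 + 1 + a + 1) :=
            add_le_of_dvd_of_lt (by linarith) hdv hU8 (by linarith [lt_of_not_ge hup])
          exact spine_base_pos2 hU hdT hHh1 ha1z hd0 (by linarith) hsb' hXlow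
        · -- rounded up, no tie: `4h ∣ ŝ_b > V ≥ U`, hence `ŝ_b ≥ U + 4h`
          have hsb' : U + 4 * Hh ≤ acc (j0 + 1 + a + 1) :=
            add_le_of_dvd_of_lt (by linarith) hR2 hU4 (by linarith [lt_of_not_ge hup])
          exact spine_base_pos1 hU hdT hHh1 ha1z hd0 (by omega) hsb' hXlow
  -- PROPAGATE from `b` to `n`
  have hbn : j0 + 1 + a + 1 ≤ n := by omega
  have hnb : ((n : ℤ) - (j0 + 1 + a + 1 : ℕ)) = (d : ℤ) - 1 - a := by
    rw [hn]; push_cast; ring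
  refine spine_propagate (H := 2 * Hh) (U := U) hbn hT0 (by rw [hU]; ring) hd0 ?_ ?_
    (by rw [hnb]; exact hbase)
  · intro j hj1 hj2
    have hlt : (acc j + z (j + 1)).natAbs < 2 ^ (m + (e' + 1) + 2) := by
      rw [show m + (e' + 1) + 2 = m + 2 + (e' + 1) by omega]; exact hPe _ (by omega) hj2
    have h1 := rneZ_err_le (m := m) (e' + 1) hlt
    rw [← hacc j hj2] at h1
    obtain ⟨h2, -⟩ := le_of_natAbs_le' h1
    rw [hHN] at h2
    rw [hEsucc]; linarith
  · intro j _ hj2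
    have h1 := hδ j hj2
    rw [hXsucc]
    have : (acc (j + 1) - (acc j + z (j + 1))) ≤ ((z (j + 1)).natAbs : ℤ) := by
      have := Int.le_natAbs (a := acc (j + 1) - (acc j + z (j + 1))); omega
    linarith

/-- BOTH SIGNS: under the hypotheses of `spineZ` (which are invariant under `z ↦ -z`; they force
`d ≥ 2`), `(T + d)·|ŝ_n - s_n| ≤ d·L_n`. [cell, gemm.tex Prop. p:fpL] -/
theorem spineZ_abs {m j0 d : ℕ} {z acc : ℕ → ℤ} (hm : 1 ≤ m) (hd : d + 1 ≤ 2 ^ m)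
    (hacc : ∀ i, i < j0 + 1 + d → acc (i + 1) = rneZ m (acc i + z (i + 1)))
    (hpre : acc j0 = sZ z j0)
    (hV0 : (acc j0 + z (j0 + 1)).natAbs < 2 ^ (m + 2))
    (hV1 : (acc (j0 + 1) + z (j0 + 1 + 1)).natAbs < 2 ^ (m + 2))
    (hδ : ∀ i, i < j0 + 1 + d →
      (acc (i + 1) - (acc i + z (i + 1))).natAbs ≤ (z (i + 1)).natAbs)
    (hhigh : ∃ i, j0 ≤ i ∧ i < j0 + 1 + d ∧ 2 ^ (m + 2) ≤ (acc i + z (i + 1)).natAbs) :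
    (2 ^ (m + 1) + (d : ℤ)) * |acc (j0 + 1 + d) - sZ z (j0 + 1 + d)|
      ≤ (d : ℤ) * LZ z (j0 + 1 + d) := by
  have h1 := spineZ hm hd hacc hpre hV0 hV1 hδ hhigh
  have e1 : ∀ i, -acc i + -z (i + 1) = -(acc i + z (i + 1)) := fun i => by ring
  have e2 : ∀ i, -acc (i + 1) - (-acc i + -z (i + 1)) = -(acc (i + 1) - (acc i + z (i + 1))) :=
    fun i => by ring
  have h2 := spineZ (z := fun i => -z i) (acc := fun i => -acc i) hm hd
    (fun i hi => show -acc (i + 1) = rneZ m (-acc i + -z (i + 1)) by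
      rw [e1, rneZ_neg, hacc i hi])
    (show -acc j0 = sZ (fun i => -z i) j0 by rw [sZ_neg, hpre])
    (show (-acc j0 + -z (j0 + 1)).natAbs < 2 ^ (m + 2) by rwa [e1, Int.natAbs_neg])
    (show (-acc (j0 + 1) + -z (j0 + 1 + 1)).natAbs < 2 ^ (m + 2) by rwa [e1, Int.natAbs_neg])
    (fun i hi => show (-acc (i + 1) - (-acc i + -z (i + 1))).natAbs ≤ (-z (i + 1)).natAbs by
      rw [e2, Int.natAbs_neg, Int.natAbs_neg]; exact hδ i hi)
    (by
      obtain ⟨i, h1, h2, h3⟩ := hhigh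
      exact ⟨i, h1, h2, show 2 ^ (m + 2) ≤ (-acc i + -z (i + 1)).natAbs by
        rwa [e1, Int.natAbs_neg]⟩)
  have h2' : 2 ^ (m + 1) * (-acc (j0 + 1 + d) - sZ (fun i => -z i) (j0 + 1 + d)) ≤
      (d : ℤ) * (LZ (fun i => -z i) (j0 + 1 + d)
        - (-acc (j0 + 1 + d) - sZ (fun i => -z i) (j0 + 1 + d))) := h2
  rw [sZ_neg, LZ_neg] at h2'
  rcases le_or_gt 0 (acc (j0 + 1 + d) - sZ z (j0 + 1 + d)) with hE | hE
  · rw [abs_of_nonneg hE]; linarith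
  · rw [abs_of_neg hE]; linarith

end Summit.Ventures.CertifiedArithmetic.LowPrec.Gemm
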